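import Mathlib
import Summits.QuantumFields.BalabanUV.Beta.DecouplingSupportFixedPoint110
import Literature.MathematicalPhysics.QuantumFieldTheory.Balaban1983to89.B13Factor210Literal

/-!
# [Balaban1988RG2Cluster] pp. 3–4 ∕ (1.38) p. 10: COMPLEMENTS to the support of the decorated terms — (i) the `s`-weighted
# walk SERIES over an arbitrary family of walks is block-local at the root component (no summability needed), (ii) the
# wall-connectedness of a walk's M-cube family FROM its M₁-scale localization domain BY NAME, (iii) the support of the
# printed example T7 = `V_□(σ(Y), H₁(σ(Y))B′)` and of T3∕T5∕T6 through the `BlockLocal` interface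
# (cell topic `Summits/QuantumFields/BalabanUV/Beta`; row-D4 terminal leaf (T4)(b), census §10.12 dictionary items (d1)(d2))

HONEST FRAMING (cell rule).  Discharging `BetaPertH` makes Bałaban's UV stability UNCONDITIONAL — a real
constructive-QFT result; NOT the continuum limit, NOT the Clay problem.  This module discharges NOTHING of `BetaPertH`.
It removes two MODEL CONVENTIONS of the sibling `DecouplingSupport110` (p204556) recorded as dictionary items in the
row-D4 census `BETA/REMAINDER-BETA.md` §10.12: (d1) «finite walk families» — print's (1.6) is a convergent SERIES; here the
decorated propagator is a `tsum` over an arbitrary index type and the support statements are proved TERMWISE, with no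
summability hypothesis at all; (d2) «the cube family of each walk is wall-connected because its localization domain is a
connected union of M₁-cubes nested in M-cubes» — discharged BY NAME through `B13Factor210Literal.wallConnected_image_cubeIdx`
(b13-g8).  It also records the support of the printed example T7 (the sibling did the «other» terms T3∕T5∕T6) and
restates the three supports through the `BlockLocal` interface, so that any model of the propagators plugs in.  [folklore];
NOT summit progress.  Unit `b2b-balaban-beta-an4-g34` (owner of `BINDER-OWNERS.md` row D4); cell `GAPS.md` C-an4-72.

CITATION HEADER (lean-in-tree rule).  [II] = T. Bałaban, *Renormalization group approach to lattice gauge field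
theories. II. Cluster expansions*, Commun. Math. Phys. **116**, 1–22 (1988) [Balaban1988RG2Cluster] (journal page =
PDF page; renders `HOME/b2b-balaban-ref1/pages/1988-cmp116-rg-II-cluster/…-p003-x2.png`, `…-p004-x2.png`,
`…-p010-x2.png` READ AS IMAGES by this unit).  WHAT IS REPRODUCED — p. 3 [PDF 3], verbatim: *"A propagator is represented
by the sum (3.107) [13] Σ_ω R₀(X₀)R_{α₁}(X₁)⋯R_{αₙ}(Xₙ), (1.6) where ω = ((0, X₀)(α₁, X₁), …, (αₙ, Xₙ)), X₀, X₁, …, Xₙ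
are simple localization domains, unions of connected families containing several cubes from π_k(1), i.e. of the size M₁
instead of M."*, *"we introduce a regular partition σ_k of the space T, in the scale corresponding to the lattice T_η, into
cubes Δ of the size R₁M₁. The number R₁ is a power of L satisfying the condition R₁M₁M⁻¹ ≦ 1. For the particular
example under consideration we take cubes of the size M, which are disjoint with the interior of □̃⁴."*, and the
decoration sentence *"we take the {Δ₁, …, Δ_m} of all cubes from σ₀ which intersect this localization domain, and we
multiply the term in (1.6) corresponding to ω by s(Δ₁)⋯s(Δ_m)"*; p. 10 [PDF 10], (1.37) `V(H₁B′) = Σ_□ V_□(H₁B′)`, (1.38)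
`∏_{Δ⊂Y∖□} ∫ds(Δ) (1∕2πi)∫ dσ(Δ)∕(σ(Δ) − s(Δ))² V_□(σ(Y), H₁(σ(Y))B′)` and *"The above expression is localized in the
interior of Y, with respect to 𝐔, 𝐉, B′ or B."*

WHAT IS CERTIFIED HERE (kernel, sorry-free; [folklore]).
§1 `walkTsum R cubes ker τ = Σ'_ω (∏_{Δ∈cubes ω∖R} τ Δ) • ker ω` over ANY index type; **`blockLocal_walkTsum`** (block-local
   at the root component of every live family — the sibling's `blockLocal_walkSum` verbatim for series: `tsum_congr`,
   `tsum_zero`; NO summability used, the `tsum` junk value being immaterial to termwise statements); `walkTsum_rootBlock_congr`.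
§2 **`blockLocal_walkTsum_twoScale`**: sites in M₁-cubes `fine x : Pt d`, M-cubes = parents `cubeIdx q (fine x)`
   (`q = M∕M₁`, `B14DomainGeom.cubeIdx`), each walk's domain `dom ω` a WALL-CONNECTED finite family of M₁-cubes carrying the
   kernel ⟹ with `cubes ω := (dom ω).image (cubeIdx q)` the series is block-local at the root component — (d2) by name.
§3 `supportedOnRootComp_T3loc∕T5loc∕T6loc_of_blockLocal` (the sibling's three supports from `BlockLocal` hypotheses per
   live family, any model); `T7loc Vbox H₁ B′ τ := V_□(H₁(τ)B′)` with `V_□` LOCALIZED in the cubes of `□̃ ⊆ R`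
   (`DecouplingSupportFixedPoint110.LocalizedIn`), **`supportedOnRootComp_T7loc`**, and the END
   **`sum_term19_T7loc_eq_sum_connected`**: (1.9) = (1.10) for the printed example with a walk-SERIES propagator on
   two-scale domains, BY NAME (`DecouplingResummation110.sum_term19_eq_sum_connected`, p204386).

NOT CLAIMED.  That Bałaban's complexified `H₁(σ(Y))` IS this series ((d1) is now purely definitional: p. 3 + [13]
(3.107)); the polydisc analyticity (d3); that print's `V_□` is localized in `□̃` (it is, by (1.37)'s `ζ_□` and [15] (80)
— a hypothesis `LocalizedIn` here); every BOUND ((1.39): `B13Ineq140`, `B13PkScaling`); NOT summit progress.  MODEL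
CONVENTIONS: as in the siblings (global parameter quantification — see `DecouplingResummation110Polydisc` for the clamp).
-/

namespace Summit.QuantumFields.BalabanUV.Beta.DecouplingSupportWalks110

open Literature.MathematicalPhysics.QuantumFieldTheory.Balaban1983to89.B14DomainGeom (Pt cubeIdx)
open Literature.MathematicalPhysics.QuantumFieldTheory.Balaban1983to89.B13Factor210 (WallConnected)
open Literature.MathematicalPhysics.QuantumFieldTheory.Balaban1983to89.B13Factor210Literal (wallConnected_image_cubeIdx)
open Summit.QuantumFields.BalabanUV.Beta.DecouplingResummation110 (rootComp SupportedOnRootComp subset_rootComp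
  subset_rootComp_of_wallConnected term19 sum_term19_eq_sum_connected)
open Summit.QuantumFields.BalabanUV.Beta.DecouplingSupport110 (VanishOff BlockLocal FieldIdle ScalarIdle kapply
  fieldIdle_kapply fieldIdle_const scalarIdle_T3loc scalarIdle_T5loc scalarIdle_T6loc T3loc T5loc T6loc weight
  weight_eq_zero weight_update_of_not_mem supportedOnRootComp_of_scalarIdle box_subset_rootComp)
open Summit.QuantumFields.BalabanUV.Beta.DecouplingSupportFixedPoint110 (LocalizedIn scalarIdle_of_localizedIn)

noncomputable section

variable {d : ℕ} {Λ : Type*}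

/-! ## §1 Countable (or arbitrary) walk families: the `s`-weighted walk SERIES is block-local — no summability needed -/

section Series

variable {Ω : Type*} {𝔸 : Type*} [Semiring 𝔸] [Module ℂ 𝔸] [TopologicalSpace 𝔸]

/-- The `s`-DECORATED WALK SERIES `H(s) = Σ_ω s(Δ₁)⋯s(Δ_m)·H_ω` over an ARBITRARY index type of walks ([II] (1.6) p. 3 is
a convergent series, [13] (3.107)–(3.108)); `tsum` (value `0` off summability — immaterial for the support statements,
which are termwise). [cite: Balaban1988RG2Cluster, (1.6)–(1.8) p.3] -/
def walkTsum (R : Finset (Pt d)) (cubes : Ω → Finset (Pt d)) (ker : Ω → Λ → Λ → 𝔸) (τ : Pt d → ℂ) :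
    Λ → Λ → 𝔸 :=
  fun x y => ∑' o, weight R cubes o τ • ker o x y

/-- **THE WALK SERIES IS BLOCK-LOCAL AT THE ROOT COMPONENT** (the sibling's `blockLocal_walkSum` for arbitrary walk
families; the proof is termwise — `tsum_congr` — and uses no summability). [cite: Balaban1988RG2Cluster, pp.3–4] -/
theorem blockLocal_walkTsum [T2Space 𝔸] (cube : Λ → Pt d) {R : Finset (Pt d)} {a₀ : Pt d}
    {cubes : Ω → Finset (Pt d)} {ker : Ω → Λ → Λ → 𝔸} (hconn : ∀ o, WallConnected (↑(cubes o) : Set (Pt d)))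
    (hsupp : ∀ o x y, ker o x y ≠ 0 → cube x ∈ cubes o ∧ cube y ∈ cubes o) (σ : Finset (Pt d)) :
    BlockLocal cube (walkTsum R cubes ker) σ (rootComp R σ a₀) where
  off := by
    intro τ hτ x y hx hy
    unfold walkTsum
    have : ∀ o, weight R cubes o τ • ker o x y = 0 := by
      intro o
      by_cases hk : ker o x y = 0
      · rw [hk, smul_zero]
      by_cases hw : weight R cubes o τ = 0
      · rw [hw, zero_smul]
      have hsub : cubes o ⊆ R ∪ σ := fun Δ hΔ => by_contra fun hΔY => hw (weight_eq_zero hτ hΔ hΔY)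
      exact absurd (subset_rootComp_of_wallConnected (hconn o) hsub (hsupp o x y hk).1 hx (hsupp o x y hk).2) hy
    simp only [this, tsum_zero]
  idle := by
    intro τ hτ Δ' hΔ'σ hΔ'Y z x y hx hy
    unfold walkTsum
    refine tsum_congr fun o => ?_
    by_cases hk : ker o x y = 0
    · rw [hk, smul_zero, smul_zero]
    congr 1
    by_cases hsub : cubes o ⊆ R ∪ σ
    · have hY : cubes o ⊆ rootComp R σ a₀ :=
        subset_rootComp_of_wallConnected (hconn o) hsub (hsupp o x y hk).1 hx
      exact weight_update_of_not_mem (fun h => hΔ'Y (hY h)) τ z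
    · obtain ⟨Δ, hΔo, hΔY⟩ := Finset.not_subset.1 hsub
      rw [weight_eq_zero (hτ.update hΔ'σ z) hΔo hΔY, weight_eq_zero hτ hΔo hΔY]

/-- Configuration locality of the root rows, series form (the sibling's `walkSum_rootBlock_congr`). [folklore] -/
theorem walkTsum_rootBlock_congr (cube : Λ → Pt d) {R σ : Finset (Pt d)} {a₀ : Pt d}
    {cubes : Ω → Finset (Pt d)} {ker ker' : Ω → Λ → Λ → 𝔸} (hconn : ∀ o, WallConnected (↑(cubes o) : Set (Pt d)))
    (hsupp : ∀ o x y, ker o x y ≠ 0 → cube x ∈ cubes o ∧ cube y ∈ cubes o)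
    (hsupp' : ∀ o x y, ker' o x y ≠ 0 → cube x ∈ cubes o ∧ cube y ∈ cubes o)
    (hagree : ∀ o, cubes o ⊆ rootComp R σ a₀ → ker o = ker' o)
    {τ : Pt d → ℂ} (hτ : VanishOff σ τ) {x : Λ} (hx : cube x ∈ rootComp R σ a₀) (y : Λ) :
    walkTsum R cubes ker τ x y = walkTsum R cubes ker' τ x y := by
  unfold walkTsum
  refine tsum_congr fun o => ?_
  by_cases hw : weight R cubes o τ = 0
  · rw [hw, zero_smul, zero_smul]
  have hsub : cubes o ⊆ R ∪ σ := fun Δ hΔ => by_contra fun hΔY => hw (weight_eq_zero hτ hΔ hΔY)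
  by_cases hk : ker o x y = 0 ∧ ker' o x y = 0
  · rw [hk.1, hk.2]
  · have hxo : cube x ∈ cubes o := by
      rcases not_and_or.1 hk with h | h
      · exact (hsupp o x y h).1
      · exact (hsupp' o x y h).1
    rw [hagree o (subset_rootComp_of_wallConnected (hconn o) hsub hxo hx)]

end Series

/-! ## §2 Two scales: the cube family of a walk from its M₁-scale localization domain -/

section TwoScales

variable {Ω : Type*} {𝔸 : Type*} [Semiring 𝔸] [Module ℂ 𝔸] [TopologicalSpace 𝔸] [T2Space 𝔸]

/-- **DICTIONARY ITEM (d2) BY NAME**: if each walk's localization domain is a WALL-CONNECTED family of M₁-cubes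
(`dom o`, indices at the M₁-scale; [II] p. 3 *"simple localization domains, unions of connected families containing
several cubes from π_k(1), i.e. of the size M₁ instead of M"*) and its kernel is supported on the sites of that domain,
then with M-cubes = parents of M₁-cubes at ratio `q = M∕M₁` (`R₁M₁M⁻¹ ≦ 1`, p. 3; `B14DomainGeom.cubeIdx`), the M-cube
families `(dom o).image (cubeIdx q)` are wall-connected (`B13Factor210Literal.wallConnected_image_cubeIdx`) and the
walk series is block-local at the root component for every live family. [cite: Balaban1988RG2Cluster, p.3 after (1.6)] -/
theorem blockLocal_walkTsum_twoScale {q : ℕ} (hq : 0 < q) (fine : Λ → Pt d) {R : Finset (Pt d)} {a₀ : Pt d}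
    {dom : Ω → Finset (Pt d)} {ker : Ω → Λ → Λ → 𝔸} (hconn : ∀ o, WallConnected (↑(dom o) : Set (Pt d)))
    (hsupp : ∀ o x y, ker o x y ≠ 0 → fine x ∈ dom o ∧ fine y ∈ dom o) (σ : Finset (Pt d)) :
    BlockLocal (fun x => cubeIdx q (fine x)) (walkTsum R (fun o => (dom o).image (cubeIdx q)) ker) σ
      (rootComp R σ a₀) := by
  classical
  refine blockLocal_walkTsum (fun x => cubeIdx q (fine x)) (fun o => ?_) (fun o x y h => ?_) σ
  · rw [Finset.coe_image]
    exact wallConnected_image_cubeIdx hq (hconn o)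
  · exact ⟨Finset.mem_image_of_mem _ (hsupp o x y h).1, Finset.mem_image_of_mem _ (hsupp o x y h).2⟩

end TwoScales

/-! ## §3 ENDs through the `BlockLocal` interface (finite sums, series, or any other model of the propagators) -/

section Ends

variable [Fintype Λ] {𝔸 : Type*} [Semiring 𝔸] {M : Type*} [AddCommGroup M] [Module 𝔸 M] {E : Type*}

/-- T5's support through the INTERFACE: block-locality of `H₁(s)`, `Δ₁(s)` at the root component of every live family
(however established — `blockLocal_walkSum`, `blockLocal_walkTsum`, `blockLocal_walkTsum_twoScale`) gives the support
hypothesis for T5's `□`-piece. [cite: Balaban1988RG2Cluster, p.4 and p.11] -/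
theorem supportedOnRootComp_T5loc_of_blockLocal [AddCommMonoid E] (cube : Λ → Pt d) (β : M →+ M →+ E)
    {box : Finset Λ} {R σ₀ : Finset (Pt d)} {a₀ : Pt d} (hR : WallConnected (↑R : Set (Pt d))) (ha₀ : a₀ ∈ R)
    (hbox : ∀ x ∈ box, cube x ∈ R) {H₁ Δ₁ : (Pt d → ℂ) → Λ → Λ → 𝔸}
    (hH : ∀ σ, σ ⊆ σ₀ → BlockLocal cube H₁ σ (rootComp R σ a₀))
    (hΔ : ∀ σ, σ ⊆ σ₀ → BlockLocal cube Δ₁ σ (rootComp R σ a₀)) (v w : Λ → M) :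
    SupportedOnRootComp (T5loc β box H₁ Δ₁ v w) R σ₀ a₀ :=
  supportedOnRootComp_of_scalarIdle fun σ hσ =>
    scalarIdle_T5loc β (box_subset_rootComp hR ha₀ hbox σ) (hH σ hσ) (hΔ σ hσ) v w

/-- T3's support through the interface. [cite: Balaban1988RG2Cluster, p.4 and p.11] -/
theorem supportedOnRootComp_T3loc_of_blockLocal [AddCommMonoid E] (cube : Λ → Pt d) (β : M →+ M →+ E)
    {box : Finset Λ} {R σ₀ : Finset (Pt d)} {a₀ : Pt d} (hR : WallConnected (↑R : Set (Pt d))) (ha₀ : a₀ ∈ R)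
    (hbox : ∀ x ∈ box, cube x ∈ R) {H₁ : (Pt d → ℂ) → Λ → Λ → 𝔸}
    (hH : ∀ σ, σ ⊆ σ₀ → BlockLocal cube H₁ σ (rootComp R σ a₀)) (u J : Λ → M) :
    SupportedOnRootComp (T3loc β box H₁ u J) R σ₀ a₀ :=
  supportedOnRootComp_of_scalarIdle fun σ hσ => scalarIdle_T3loc β (box_subset_rootComp hR ha₀ hbox σ) (hH σ hσ) u J

/-- T6's support through the interface. [cite: Balaban1988RG2Cluster, p.4 and p.11] -/
theorem supportedOnRootComp_T6loc_of_blockLocal [AddCommMonoid E] (cube : Λ → Pt d) (β : M →+ M →+ E)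
    {box : Finset Λ} {R σ₀ : Finset (Pt d)} {a₀ : Pt d} (hR : WallConnected (↑R : Set (Pt d))) (ha₀ : a₀ ∈ R)
    (hbox : ∀ x ∈ box, cube x ∈ R) {H₁ Δ₁ : (Pt d → ℂ) → Λ → Λ → 𝔸}
    (hH : ∀ σ, σ ⊆ σ₀ → BlockLocal cube H₁ σ (rootComp R σ a₀))
    (hΔ : ∀ σ, σ ⊆ σ₀ → BlockLocal cube Δ₁ σ (rootComp R σ a₀)) (w : Λ → M) :
    SupportedOnRootComp (T6loc β box H₁ Δ₁ w) R σ₀ a₀ :=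
  supportedOnRootComp_T5loc_of_blockLocal cube β hR ha₀ hbox hH hΔ w w

/-- THE PRINTED EXAMPLE T7 = `(1∕g_k²)V(H₁B′)` localized by `ζ_□` ([II] (1.37)–(1.38) p. 10: `V_□(σ(Y), H₁(σ(Y))B′)`,
*"localized in the interior of Y, with respect to 𝐔, 𝐉, B′ or B"*): a functional `V_□` of the field LOCALIZED in the
cubes of `□̃` ⊆ `R`, evaluated on `H₁(s)B′`. [cite: Balaban1988RG2Cluster, (1.38) p.10] -/
def T7loc (Vbox : (Λ → M) → E) (H₁ : (Pt d → ℂ) → Λ → Λ → 𝔸) (Bp : Λ → M) (τ : Pt d → ℂ) : E :=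
  Vbox (kapply (H₁ τ) Bp)

/-- **SUPPORT OF T7's `□`-PIECE** ((1.38)'s «localized in the interior of Y»): a localized functional of `H₁(s)B′` with
`H₁(s)` block-local at the root component of every live family satisfies the support hypothesis; hence (1.9) = (1.10)
for it BY NAME. [cite: Balaban1988RG2Cluster, (1.38) p.10] -/
theorem supportedOnRootComp_T7loc (cube : Λ → Pt d) {Vbox : (Λ → M) → E} {R σ₀ : Finset (Pt d)} {a₀ : Pt d}
    (hR : WallConnected (↑R : Set (Pt d))) (ha₀ : a₀ ∈ R) (hV : LocalizedIn cube Vbox R)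
    {H₁ : (Pt d → ℂ) → Λ → Λ → 𝔸} (hH : ∀ σ, σ ⊆ σ₀ → BlockLocal cube H₁ σ (rootComp R σ a₀)) (Bp : Λ → M) :
    SupportedOnRootComp (T7loc Vbox H₁ Bp) R σ₀ a₀ :=
  supportedOnRootComp_of_scalarIdle fun σ hσ =>
    scalarIdle_of_localizedIn hV (subset_rootComp hR ha₀ σ) (fieldIdle_kapply (hH σ hσ) (fieldIdle_const cube Bp σ _))

open Classical in
/-- **(1.9) = (1.10) FOR THE PRINTED EXAMPLE T7** with a walk-SERIES propagator and two-scale domains — every dictionary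
item of census §10.12 except «`H₁(σ)` IS this series» ((d1), definitional) and the polydisc analyticity (d3) discharged
BY NAME. [cite: Balaban1988RG2Cluster, (1.10) p.4 and (1.38) p.10] -/
theorem sum_term19_T7loc_eq_sum_connected [NormedAddCommGroup E] [NormedSpace ℂ E] [CompleteSpace E] {Ω : Type*}
    [Module ℂ 𝔸] [TopologicalSpace 𝔸] [T2Space 𝔸] (ρ : ℝ) {q : ℕ} (hq : 0 < q) (fine : Λ → Pt d)
    {Vbox : (Λ → M) → E} {R σ₀ : Finset (Pt d)} {a₀ : Pt d} (hR : WallConnected (↑R : Set (Pt d))) (ha₀ : a₀ ∈ R)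
    (hV : LocalizedIn (fun x => cubeIdx q (fine x)) Vbox R) {dom : Ω → Finset (Pt d)} {ker : Ω → Λ → Λ → 𝔸}
    (hconn : ∀ o, WallConnected (↑(dom o) : Set (Pt d)))
    (hsupp : ∀ o x y, ker o x y ≠ 0 → fine x ∈ dom o ∧ fine y ∈ dom o) (Bp : Λ → M) :
    ∑ σ ∈ σ₀.powerset, term19 ρ (T7loc Vbox (walkTsum R (fun o => (dom o).image (cubeIdx q)) ker) Bp) σ
      = ∑ σ ∈ σ₀.powerset with WallConnected (↑(R ∪ σ) : Set (Pt d)),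
          term19 ρ (T7loc Vbox (walkTsum R (fun o => (dom o).image (cubeIdx q)) ker) Bp) σ :=
  sum_term19_eq_sum_connected ρ hR ha₀
    (supportedOnRootComp_T7loc _ hR ha₀ hV (fun σ _ => blockLocal_walkTsum_twoScale hq fine hconn hsupp σ) Bp)

end Ends

end

end Summit.QuantumFields.BalabanUV.Beta.DecouplingSupportWalks110
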